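import Mathlib
import Summits.RiemannHypothesis.RiemannHypothesis.Theorems.IntegerScrewPropK
import Summits.RiemannHypothesis.RiemannHypothesis.Theorems.IntegerScrewHubGamma
import Summits.RiemannHypothesis.RiemannHypothesis.Theorems.IntegerScrewHubMass
import HarnessLib

/-!
# Route `IntegerScrew` — PROPOSITION K″: the window functional of a thin-bottom window, routed through the hubs
# (CONTINUUM-LIMIT §27.2)

The window functional of the window `W = (Q, R]` of `Ω_R` against its bottom `B = [1, Q]`,
`WF(g) = Σ_{x∈W} g(x)/x − (S_W/H_Q)·Σ_{b∈B} g(b)/b` (`S_W = Σ_W 1/x`, `H_Q = Σ_B 1/b`), is bounded against the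
Dirichlet form `D_{Ω_R}(g) = Σ_{x≤R}(1/x)Σ_{n∣x}Λ(n)(g x − g(x/n))²` by an EXPLICIT flow with no landing condition:
`WF = T_W − (S_W/H_Q)·T_B` with the root functionals `T_W = Σ_W (1/x)(g x − g 1)`, `T_B = Σ_B (1/b)(g b − g 1)`;
`T_W` is a tree functional (`IntegerScrewPropK.subset_root_functional_sq_le`), and `T_B` is routed through the hubs
`P ∈ (Q, Y]` (`QY ≤ R`, all primes of `P` above `Q`, harmonic mass `M`):
`M·T_B = U − Γ`, `U = Σ_{b,P}(1/(bP))(g(bP) − g 1)` (a tree functional on the set `B·hubs ⊆ [1, R]`) and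
`Γ = Σ_b(1/b)Σ_P(1/P)(g(bP) − g b)` (leg `γ`, `IntegerScrewHubGamma.hubGamma_sq_le`).  Hence

* **`propKK_smooth`** / **`propKK`** — inside the atom `{x ≤ R : x N-smooth}` (`Q, Y < N`) / in `Ω_R`: for
  `1 ≤ Q`, `2 ≤ Y`, `QY ≤ R`, `M > 0` and every `g`:
  `WF(g)² ≤ 3·[E_K(R) + (S_W/(H_Q·M))²·(H_Q·E_α(Q,Y) + E_K(R))]·D_{Ω_R}(g)`,
  `E_K(R) = e¹⁰(log R + log 4 + e⁵ log(R+1)(log log R + 4))` (PROP. K's energy),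
  `E_α(Q,Y) = (4(1+e⁵)²/log²(Q+1))·(log Y + log 4 + e⁵ log(Y+1)(log log Y + 4))` (leg `α`'s energy);
* **`propKK_explicit`** — the same with `M` discharged by `IntegerScrewHubMass.hubMass_ge_log` under
  `π_Q = Π_{p≤Q}(1 − 1/p)⁻¹ < log(Y+1)`: coefficient `(S_W·π_Q/(H_Q·(log(Y+1) − π_Q)))²`.

With `Y = R/Q`, `S_W ≤ H_R ≲ log R`, `H_Q ≍ log Q`, `M ≥ log(Y+1)/π_Q − 1 ≳ log R/(e⁵ log Q)` (`IntegerScrewHubMass`)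
every term is `O(log R·log log R)·D`: in κ-units **κ(thin bottom) = O((log Q + 1)·log log R)**, PROP. K″ of
CONTINUUM-LIMIT §27.2 (constants crude and irrelevant).  RH-free, elementary.
Nothing in this file bears on the truth of RH.
References: CONTINUUM-LIMIT §27 (rh-explicit A6-PIVOT); M. Suzuki, J. Lond. Math. Soc. (2) 108 (2023) 1448–1487
[Suzuki2023] for the screw matrices this serves.
-/

noncomputable section

set_option linter.dupNamespace false -- D-0017: `Summit.<S>.<S>.…` is the designed namespace

namespace Summit.RiemannHypothesis.RiemannHypothesis.Theorems.IntegerScrew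

open Finset Real
open ArithmeticFunction (vonMangoldt)

/-- `(a + b − d)² ≤ 3(a² + b² + d²)`. -/
theorem add_sub_sq_le_three (a b d : ℝ) : (a + b - d) ^ 2 ≤ 3 * (a ^ 2 + b ^ 2 + d ^ 2) := by
  nlinarith [sq_nonneg (a - b), sq_nonneg (a + d), sq_nonneg (b + d)]

/-- **Routing the bottom's root functional through the hubs**: with `B = [1, Q]`, hubs `H ⊆ (Q, Y]` (all primes
`≥ Q+1`) of harmonic mass `M`,
`M·Σ_{b∈B}(1/b)(g b − g 1) = Σ_{x ∈ B·H}(1/x)(g x − g 1) − Σ_{b∈B}(1/b)Σ_{P∈H}(1/P)(g(bP) − g b)`. -/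
theorem bottom_functional_routing (Q Y : ℕ) (g : ℕ → ℝ) :
    (∑ P ∈ (Ioc Q Y).filter (fun r => ∀ q ∈ r.primeFactors, Q + 1 ≤ q), 1 / (P : ℝ)) *
        ∑ b ∈ Icc 1 Q, (1 / (b : ℝ)) * (g b - g 1) =
      ∑ x ∈ (Icc 1 Q ×ˢ (Ioc Q Y).filter (fun r => ∀ q ∈ r.primeFactors, Q + 1 ≤ q)).image
          (fun z : ℕ × ℕ => z.1 * z.2), (1 / (x : ℝ)) * (g x - g 1) -
        ∑ b ∈ Icc 1 Q, (1 / (b : ℝ)) *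
          ∑ P ∈ (Ioc Q Y).filter (fun r => ∀ q ∈ r.primeFactors, Q + 1 ≤ q),
            (1 / (P : ℝ)) * (g (b * P) - g b) := by
  set H := (Ioc Q Y).filter (fun r => ∀ q ∈ r.primeFactors, Q + 1 ≤ q) with hH
  have hinj : Set.InjOn (fun z : ℕ × ℕ => z.1 * z.2) ↑(Icc 1 Q ×ˢ H) := by
    intro z hz z' hz' hzz
    have hz1 := Finset.mem_product.1 (Finset.mem_coe.1 hz)
    have hz2 := Finset.mem_product.1 (Finset.mem_coe.1 hz')
    have hH1 := Finset.mem_filter.1 hz1.2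
    have hH2 := Finset.mem_filter.1 hz2.2
    have := smooth_mul_rough_inj hz1.1 hz2.1 (by have := (Finset.mem_Ioc.1 hH1.1).1; omega)
      (by have := (Finset.mem_Ioc.1 hH2.1).1; omega) hH1.2 hH2.2 hzz
    exact Prod.ext this.1 this.2
  rw [Finset.sum_image (f := fun x : ℕ => (1 / (x : ℝ)) * (g x - g 1)) hinj, Finset.sum_product]
  simp only
  rw [← Finset.sum_sub_distrib, Finset.mul_sum]
  refine Finset.sum_congr rfl fun b hb => ?_
  have hb0 : (b : ℝ) ≠ 0 := by
    have := (Finset.mem_Icc.1 hb).1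
    exact_mod_cast (show b ≠ 0 by omega)
  rw [Finset.sum_mul, Finset.mul_sum, ← Finset.sum_sub_distrib]
  refine Finset.sum_congr rfl fun P hP => ?_
  have hP0 : (P : ℝ) ≠ 0 := by
    have := (Finset.mem_Ioc.1 (Finset.mem_filter.1 hP).1).1
    exact_mod_cast (show P ≠ 0 by omega)
  push_cast
  field_simp
  ring

/-- **PROPOSITION K″ inside an atom (CONTINUUM-LIMIT §27.2 (iii)): the window functional of the thin-bottom window
`{Q < x ≤ R : x N-smooth}` through the hubs.**  For `1 ≤ Q < N`, `2 ≤ Y < N`, `QY ≤ R`, hubs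
`H = {P ∈ (Q, Y] : every prime of P ≥ Q+1}` (all `N`-smooth) with `M = Σ_H 1/P > 0`, and every `g`, with
`𝒜 = {x ≤ R : x N-smooth}`, `W = 𝒜 ∩ (Q, R]`, `S_W = Σ_W 1/x`, `H_Q = Σ_{b≤Q} 1/b`:
`(Σ_W g x/x − (S_W/H_Q)·Σ_{b≤Q} g b/b)² ≤ 3·[E_K(R) + (S_W/(H_Q·M))²·(H_Q·E_α(Q,Y) + E_K(R))]·D_𝒜(g)`
(for the near-extreme cell `(p⁻, R, p)`: `N = p+1`, `Q = R/p`, `Y = p`). -/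
theorem propKK_smooth {Q Y R N : ℕ} (hQ : 1 ≤ Q) (hY : 2 ≤ Y) (hR : Q * Y ≤ R) (hQN : Q < N) (hYN : Y < N)
    (hM : 0 < ∑ P ∈ (Ioc Q Y).filter (fun r => ∀ q ∈ r.primeFactors, Q + 1 ≤ q), 1 / (P : ℝ)) (g : ℕ → ℝ) :
    (∑ x ∈ (Ioc Q R).filter (· ∈ Nat.smoothNumbers N), g x / x -
        (∑ x ∈ (Ioc Q R).filter (· ∈ Nat.smoothNumbers N), 1 / (x : ℝ)) / (∑ b ∈ Icc 1 Q, 1 / (b : ℝ)) *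
          ∑ b ∈ Icc 1 Q, g b / b) ^ 2 ≤
      3 * (Real.exp 10 * (Real.log R + Real.log 4 + Real.exp 5 * Real.log ((R : ℝ) + 1) * (Real.log (Real.log R) + 4)) +
          ((∑ x ∈ (Ioc Q R).filter (· ∈ Nat.smoothNumbers N), 1 / (x : ℝ)) / ((∑ b ∈ Icc 1 Q, 1 / (b : ℝ)) *
              ∑ P ∈ (Ioc Q Y).filter (fun r => ∀ q ∈ r.primeFactors, Q + 1 ≤ q), 1 / (P : ℝ))) ^ 2 *
            ((∑ b ∈ Icc 1 Q, 1 / (b : ℝ)) *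
                (4 * (1 + Real.exp 5) ^ 2 / Real.log ((Q : ℝ) + 1) ^ 2 *
                  (Real.log Y + Real.log 4 + Real.exp 5 * Real.log ((Y : ℝ) + 1) * (Real.log (Real.log Y) + 4))) +
              Real.exp 10 * (Real.log R + Real.log 4 +
                Real.exp 5 * Real.log ((R : ℝ) + 1) * (Real.log (Real.log R) + 4)))) *
        ∑ x ∈ (Icc 1 R).filter (· ∈ Nat.smoothNumbers N),
          (1 / (x : ℝ)) * ∑ n ∈ x.divisors, (vonMangoldt n : ℝ) * (g x - g (x / n)) ^ 2 := by
  set H := (Ioc Q Y).filter (fun r => ∀ q ∈ r.primeFactors, Q + 1 ≤ q) with hH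
  set A := (Icc 1 R).filter (· ∈ Nat.smoothNumbers N) with hA
  set Wn := (Ioc Q R).filter (· ∈ Nat.smoothNumbers N) with hWn
  set M := ∑ P ∈ H, 1 / (P : ℝ) with hMdef
  set SW := ∑ x ∈ Wn, 1 / (x : ℝ) with hSW
  set HQ := ∑ b ∈ Icc 1 Q, 1 / (b : ℝ) with hHQ
  set D := ∑ x ∈ A, (1 / (x : ℝ)) * ∑ n ∈ x.divisors, (vonMangoldt n : ℝ) * (g x - g (x / n)) ^ 2 with hD
  set EK := Real.exp 10 * (Real.log R + Real.log 4 +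
    Real.exp 5 * Real.log ((R : ℝ) + 1) * (Real.log (Real.log R) + 4)) with hEK
  set Eα := 4 * (1 + Real.exp 5) ^ 2 / Real.log ((Q : ℝ) + 1) ^ 2 *
    (Real.log Y + Real.log 4 + Real.exp 5 * Real.log ((Y : ℝ) + 1) * (Real.log (Real.log Y) + 4)) with hEα
  set TW := ∑ x ∈ Wn, (1 / (x : ℝ)) * (g x - g 1) with hTW
  set TB := ∑ b ∈ Icc 1 Q, (1 / (b : ℝ)) * (g b - g 1) with hTB
  set U := ∑ x ∈ (Icc 1 Q ×ˢ H).image (fun z : ℕ × ℕ => z.1 * z.2), (1 / (x : ℝ)) * (g x - g 1) with hU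
  set Γ := ∑ b ∈ Icc 1 Q, (1 / (b : ℝ)) * ∑ P ∈ H, (1 / (P : ℝ)) * (g (b * P) - g b) with hΓ
  have hR2 : 2 ≤ R := le_trans (by nlinarith) hR
  have hHQpos : 0 < HQ := Finset.sum_pos (fun b hb => by
    have := (Finset.mem_Icc.1 hb).1; positivity) ⟨1, Finset.mem_Icc.2 ⟨le_rfl, hQ⟩⟩
  have hD0 : 0 ≤ D := Finset.sum_nonneg fun x _ => mul_nonneg (by positivity)
    (Finset.sum_nonneg fun n _ => mul_nonneg ArithmeticFunction.vonMangoldt_nonneg (sq_nonneg _))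
  -- (1) WF = TW − (SW/HQ)·TB
  have hW : ∑ x ∈ Wn, g x / x = TW + g 1 * SW := by
    rw [hTW, hSW, Finset.mul_sum, ← Finset.sum_add_distrib]
    exact Finset.sum_congr rfl fun x _ => by ring
  have hB : ∑ b ∈ Icc 1 Q, g b / b = TB + g 1 * HQ := by
    rw [hTB, hHQ, Finset.mul_sum, ← Finset.sum_add_distrib]
    exact Finset.sum_congr rfl fun x _ => by ring
  have hWF : ∑ x ∈ Wn, g x / x - SW / HQ * ∑ b ∈ Icc 1 Q, g b / b = TW - SW / HQ * TB := by
    rw [hW, hB]; field_simp; ring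
  -- (2) M·TB = U − Γ
  have hroute : M * TB = U - Γ := bottom_functional_routing Q Y g
  have hTBeq : TB = (U - Γ) / M := by rw [← hroute]; field_simp
  -- (3) the three bounds, all against D_𝒜
  have hTWle : TW ^ 2 ≤ EK * D :=
    subset_root_functional_sq_le_smooth hR2 N (S := Wn) (fun x hx => by
      have hx' := Finset.mem_filter.1 hx
      have := Finset.mem_Ioc.1 hx'.1
      exact Finset.mem_filter.2 ⟨Finset.mem_Icc.2 ⟨by omega, this.2⟩, hx'.2⟩) g
  have hUle : U ^ 2 ≤ EK * D := by
    refine subset_root_functional_sq_le_smooth hR2 N (S := (Icc 1 Q ×ˢ H).image (fun z : ℕ × ℕ => z.1 * z.2)) ?_ g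
    intro x hx
    obtain ⟨z, hz, rfl⟩ := Finset.mem_image.1 hx
    have hz' := Finset.mem_product.1 hz
    have hb := Finset.mem_Icc.1 hz'.1
    have hP := Finset.mem_Ioc.1 (Finset.mem_filter.1 hz'.2).1
    refine Finset.mem_filter.2 ⟨Finset.mem_Icc.2 ⟨Nat.one_le_iff_ne_zero.2 (Nat.mul_ne_zero (by omega) (by omega)),
      (Nat.mul_le_mul hb.2 hP.2).trans hR⟩, ?_⟩
    exact Nat.mul_mem_smoothNumbers (Nat.mem_smoothNumbers_of_lt (by omega) (by omega))
      (Nat.mem_smoothNumbers_of_lt (by omega) (by omega))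
  have hΓle : Γ ^ 2 ≤ HQ * Eα * D := by
    refine (hubGamma_sq_le_smooth hQ hY hQN hYN g).trans ?_
    have hEα0 : 0 ≤ HQ * Eα := by
      have hY2 : (2 : ℝ) ≤ Y := by exact_mod_cast hY
      have h1 : 0 ≤ Real.log Y := Real.log_nonneg (by linarith)
      have h2 : 0 ≤ Real.log 4 := Real.log_nonneg (by norm_num)
      have h3 : 0 ≤ Real.log ((Y : ℝ) + 1) := Real.log_nonneg (by linarith)
      have h4 : 0 ≤ Real.log (Real.log Y) + 4 := by
        have hl2 : (1 : ℝ) / 2 < Real.log 2 := by linarith [Real.log_two_gt_d9]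
        have hlY : Real.log 2 ≤ Real.log Y := Real.log_le_log (by norm_num) hY2
        have hll : Real.log (1 / 2) ≤ Real.log (Real.log Y) := Real.log_le_log (by norm_num) (by linarith)
        have : Real.log (1 / 2) = -Real.log 2 := by rw [one_div, Real.log_inv]
        linarith [Real.log_two_lt_d9]
      positivity
    refine mul_le_mul_of_nonneg_left ?_ hEα0
    exact Finset.sum_le_sum_of_subset_of_nonneg (fun x hx => by
        have hx' := Finset.mem_filter.1 hx
        have := Finset.mem_Icc.1 hx'.1
        exact Finset.mem_filter.2 ⟨Finset.mem_Icc.2 ⟨this.1, this.2.trans hR⟩, hx'.2⟩)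
      fun x _ _ => mul_nonneg (by positivity)
        (Finset.sum_nonneg fun n _ => mul_nonneg ArithmeticFunction.vonMangoldt_nonneg (sq_nonneg _))
  -- (4) assemble
  rw [hWF, hTBeq]
  set c := SW / (HQ * M) with hc
  have hform : TW - SW / HQ * ((U - Γ) / M) = TW + c * Γ - c * U := by
    rw [hc]; field_simp; ring
  rw [hform]
  have h3 := add_sub_sq_le_three TW (c * Γ) (c * U)
  have hc2 : 0 ≤ c ^ 2 := sq_nonneg c
  have e1 : (c * Γ) ^ 2 ≤ c ^ 2 * (HQ * Eα * D) := by rw [mul_pow]; exact mul_le_mul_of_nonneg_left hΓle hc2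
  have e2 : (c * U) ^ 2 ≤ c ^ 2 * (EK * D) := by rw [mul_pow]; exact mul_le_mul_of_nonneg_left hUle hc2
  have hcdef : c = SW / (HQ * M) := hc
  calc (TW + c * Γ - c * U) ^ 2 ≤ 3 * (TW ^ 2 + (c * Γ) ^ 2 + (c * U) ^ 2) := h3
    _ ≤ 3 * (EK * D + c ^ 2 * (HQ * Eα * D) + c ^ 2 * (EK * D)) := by linarith
    _ = 3 * (EK + (SW / (HQ * M)) ^ 2 * (HQ * Eα + EK)) * D := by rw [hcdef]; ring

/-- **PROPOSITION K″ (CONTINUUM-LIMIT §27.2): the window functional of the thin-bottom window `(Q, R]` of `Ω_R`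
through the hubs.**  For `1 ≤ Q`, `2 ≤ Y`, `QY ≤ R`, hubs `H = {P ∈ (Q, Y] : every prime of P ≥ Q+1}` with
`M = Σ_H 1/P > 0`, and every `g`:
`(Σ_{Q<x≤R} g x/x − (S_W/H_Q)·Σ_{b≤Q} g b/b)² ≤ 3·[E_K(R) + (S_W/(H_Q·M))²·(H_Q·E_α(Q,Y) + E_K(R))]·D_{Ω_R}(g)`
(`propKK_smooth` with `N = R + 1`: every `x ≤ R` is `(R+1)`-smooth). -/
theorem propKK {Q Y R : ℕ} (hQ : 1 ≤ Q) (hY : 2 ≤ Y) (hR : Q * Y ≤ R)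
    (hM : 0 < ∑ P ∈ (Ioc Q Y).filter (fun r => ∀ q ∈ r.primeFactors, Q + 1 ≤ q), 1 / (P : ℝ)) (g : ℕ → ℝ) :
    (∑ x ∈ Ioc Q R, g x / x -
        (∑ x ∈ Ioc Q R, 1 / (x : ℝ)) / (∑ b ∈ Icc 1 Q, 1 / (b : ℝ)) * ∑ b ∈ Icc 1 Q, g b / b) ^ 2 ≤
      3 * (Real.exp 10 * (Real.log R + Real.log 4 + Real.exp 5 * Real.log ((R : ℝ) + 1) * (Real.log (Real.log R) + 4)) +
          ((∑ x ∈ Ioc Q R, 1 / (x : ℝ)) / ((∑ b ∈ Icc 1 Q, 1 / (b : ℝ)) *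
              ∑ P ∈ (Ioc Q Y).filter (fun r => ∀ q ∈ r.primeFactors, Q + 1 ≤ q), 1 / (P : ℝ))) ^ 2 *
            ((∑ b ∈ Icc 1 Q, 1 / (b : ℝ)) *
                (4 * (1 + Real.exp 5) ^ 2 / Real.log ((Q : ℝ) + 1) ^ 2 *
                  (Real.log Y + Real.log 4 + Real.exp 5 * Real.log ((Y : ℝ) + 1) * (Real.log (Real.log Y) + 4))) +
              Real.exp 10 * (Real.log R + Real.log 4 +
                Real.exp 5 * Real.log ((R : ℝ) + 1) * (Real.log (Real.log R) + 4)))) *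
        ∑ x ∈ Icc 1 R, (1 / (x : ℝ)) * ∑ n ∈ x.divisors, (vonMangoldt n : ℝ) * (g x - g (x / n)) ^ 2 := by
  have hQY : Q ≤ Q * Y := Nat.le_mul_of_pos_right Q (by omega)
  have hYQ : Y ≤ Q * Y := Nat.le_mul_of_pos_left Y (by omega)
  have h := propKK_smooth (N := R + 1) hQ hY hR (by omega) (by omega) hM g
  have hW : (Ioc Q R).filter (· ∈ Nat.smoothNumbers (R + 1)) = Ioc Q R :=
    Finset.filter_true_of_mem fun x hx => by
      have := Finset.mem_Ioc.1 hx; exact Nat.mem_smoothNumbers_of_lt (by omega) (by omega)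
  have hA : (Icc 1 R).filter (· ∈ Nat.smoothNumbers (R + 1)) = Icc 1 R :=
    Finset.filter_true_of_mem fun x hx => by
      have := Finset.mem_Icc.1 hx; exact Nat.mem_smoothNumbers_of_lt (by omega) (by omega)
  rw [hW, hA] at h
  exact h

/-- `log log N + 4 ≥ 0` for `N ≥ 2`. -/
theorem loglog_add_four_nonneg {N : ℕ} (hN : 2 ≤ N) : 0 ≤ Real.log (Real.log N) + 4 := by
  have hN2 : (2 : ℝ) ≤ N := by exact_mod_cast hN
  have hl2 : (1 : ℝ) / 2 < Real.log 2 := by linarith [Real.log_two_gt_d9]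
  have hlY : Real.log 2 ≤ Real.log N := Real.log_le_log (by norm_num) hN2
  have hll : Real.log (1 / 2) ≤ Real.log (Real.log N) := Real.log_le_log (by norm_num) (by linarith)
  have : Real.log (1 / 2) = -Real.log 2 := by rw [one_div, Real.log_inv]
  linarith [Real.log_two_lt_d9]

/-- PROP. K's energy bound is nonnegative: `0 ≤ E_K(N)` for `N ≥ 2`. -/
theorem EK_nonneg {N : ℕ} (hN : 2 ≤ N) :
    0 ≤ Real.exp 10 * (Real.log N + Real.log 4 + Real.exp 5 * Real.log ((N : ℝ) + 1) * (Real.log (Real.log N) + 4)) := by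
  have hN2 : (2 : ℝ) ≤ N := by exact_mod_cast hN
  have h1 : 0 ≤ Real.log N := Real.log_nonneg (by linarith)
  have h2 : 0 ≤ Real.log 4 := Real.log_nonneg (by norm_num)
  have h3 : 0 ≤ Real.log ((N : ℝ) + 1) := Real.log_nonneg (by linarith)
  have h4 := loglog_add_four_nonneg hN
  positivity

/-- **PROPOSITION K″, hub mass discharged** (CONTINUUM-LIMIT §27.2 with §27.1): for `1 ≤ Q ≤ Y`, `2 ≤ Y`, `QY ≤ R` and
`π_Q := Π_{p<Q+1}(1 − 1/p)⁻¹ < log(Y+1)` (so that the hubs have mass `M ≥ log(Y+1)/π_Q − 1 > 0`,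
`IntegerScrewHubMass.hubMass_ge_log`), for every `g`:
`WF(g)² ≤ 3·[E_K(R) + (S_W·π_Q/(H_Q·(log(Y+1) − π_Q)))²·(H_Q·E_α(Q,Y) + E_K(R))]·D_{Ω_R}(g)`. -/
theorem propKK_explicit {Q Y R : ℕ} (hQ : 1 ≤ Q) (hY : 2 ≤ Y) (hQY : Q ≤ Y) (hR : Q * Y ≤ R)
    (hπ : ∏ p ∈ (Q + 1).primesBelow, (1 - (1 : ℝ) / p)⁻¹ < Real.log ((Y : ℝ) + 1)) (g : ℕ → ℝ) :
    (∑ x ∈ Ioc Q R, g x / x -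
        (∑ x ∈ Ioc Q R, 1 / (x : ℝ)) / (∑ b ∈ Icc 1 Q, 1 / (b : ℝ)) * ∑ b ∈ Icc 1 Q, g b / b) ^ 2 ≤
      3 * (Real.exp 10 * (Real.log R + Real.log 4 + Real.exp 5 * Real.log ((R : ℝ) + 1) * (Real.log (Real.log R) + 4)) +
          ((∑ x ∈ Ioc Q R, 1 / (x : ℝ)) * (∏ p ∈ (Q + 1).primesBelow, (1 - (1 : ℝ) / p)⁻¹) /
              ((∑ b ∈ Icc 1 Q, 1 / (b : ℝ)) *
                (Real.log ((Y : ℝ) + 1) - ∏ p ∈ (Q + 1).primesBelow, (1 - (1 : ℝ) / p)⁻¹))) ^ 2 *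
            ((∑ b ∈ Icc 1 Q, 1 / (b : ℝ)) *
                (4 * (1 + Real.exp 5) ^ 2 / Real.log ((Q : ℝ) + 1) ^ 2 *
                  (Real.log Y + Real.log 4 + Real.exp 5 * Real.log ((Y : ℝ) + 1) * (Real.log (Real.log Y) + 4))) +
              Real.exp 10 * (Real.log R + Real.log 4 +
                Real.exp 5 * Real.log ((R : ℝ) + 1) * (Real.log (Real.log R) + 4)))) *
        ∑ x ∈ Icc 1 R, (1 / (x : ℝ)) * ∑ n ∈ x.divisors, (vonMangoldt n : ℝ) * (g x - g (x / n)) ^ 2 := by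
  set Pr := ∏ p ∈ (Q + 1).primesBelow, (1 - (1 : ℝ) / p)⁻¹ with hPr
  set M := ∑ P ∈ (Ioc Q Y).filter (fun r => ∀ q ∈ r.primeFactors, Q + 1 ≤ q), 1 / (P : ℝ) with hM
  set SW := ∑ x ∈ Ioc Q R, 1 / (x : ℝ) with hSW
  set HQ := ∑ b ∈ Icc 1 Q, 1 / (b : ℝ) with hHQ
  set L1 := Real.log ((Y : ℝ) + 1) with hL1
  have hR2 : 2 ≤ R := le_trans (by nlinarith) hR
  have hPr0 : 0 < Pr := by
    refine Finset.prod_pos fun p hp => ?_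
    have hp2 : (2 : ℝ) ≤ p := by exact_mod_cast (Nat.mem_primesBelow.1 hp).2.two_le
    have : (1 : ℝ) / p ≤ 1 / 2 := by
      rw [div_le_div_iff₀ (by linarith) (by norm_num)]; linarith
    have : 0 < 1 - (1 : ℝ) / p := by linarith
    positivity
  have hMge : L1 / Pr - 1 ≤ M := hubMass_ge_log hQY
  have hgap : 0 < L1 - Pr := by linarith
  have hMpos : 0 < M := by
    have : 0 < L1 / Pr - 1 := by rw [sub_pos, lt_div_iff₀ hPr0]; linarith
    linarith
  have hHQpos : 0 < HQ := Finset.sum_pos (fun b hb => by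
    have := (Finset.mem_Icc.1 hb).1; positivity) ⟨1, Finset.mem_Icc.2 ⟨le_rfl, hQ⟩⟩
  have hSW0 : 0 ≤ SW := Finset.sum_nonneg fun x _ => by positivity
  have h := propKK hQ hY hR hMpos g
  -- compare the M-coefficients: SW/(HQ·M) ≤ SW·Pr/(HQ·(L1 − Pr))
  have hcoef : SW / (HQ * M) ≤ SW * Pr / (HQ * (L1 - Pr)) := by
    rw [div_le_div_iff₀ (by positivity) (by positivity)]
    -- SW·(HQ·(L1−Pr)) ≤ SW·Pr·(HQ·M) ⟸ L1 − Pr ≤ Pr·M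
    have hPM : L1 - Pr ≤ Pr * M := by
      have := mul_le_mul_of_nonneg_left hMge hPr0.le
      have e : Pr * (L1 / Pr - 1) = L1 - Pr := by field_simp
      linarith
    have := mul_le_mul_of_nonneg_left hPM (mul_nonneg hSW0 hHQpos.le)
    nlinarith
  have hcoef0 : 0 ≤ SW / (HQ * M) := by positivity
  have hsq : (SW / (HQ * M)) ^ 2 ≤ (SW * Pr / (HQ * (L1 - Pr))) ^ 2 := pow_le_pow_left₀ hcoef0 hcoef 2
  have hEK := EK_nonneg hR2
  have hEα : 0 ≤ HQ * (4 * (1 + Real.exp 5) ^ 2 / Real.log ((Q : ℝ) + 1) ^ 2 *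
      (Real.log Y + Real.log 4 + Real.exp 5 * Real.log ((Y : ℝ) + 1) * (Real.log (Real.log Y) + 4))) := by
    have hY2 : (2 : ℝ) ≤ Y := by exact_mod_cast hY
    have h1 : 0 ≤ Real.log Y := Real.log_nonneg (by linarith)
    have h2 : 0 ≤ Real.log 4 := Real.log_nonneg (by norm_num)
    have h3 : 0 ≤ Real.log ((Y : ℝ) + 1) := Real.log_nonneg (by linarith)
    have h4 := loglog_add_four_nonneg hY
    positivity
  have hD0 : 0 ≤ ∑ x ∈ Icc 1 R, (1 / (x : ℝ)) * ∑ n ∈ x.divisors, (vonMangoldt n : ℝ) * (g x - g (x / n)) ^ 2 :=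
    Finset.sum_nonneg fun x _ => mul_nonneg (by positivity)
      (Finset.sum_nonneg fun n _ => mul_nonneg ArithmeticFunction.vonMangoldt_nonneg (sq_nonneg _))
  refine h.trans (mul_le_mul_of_nonneg_right ?_ hD0)
  have := mul_le_mul_of_nonneg_right hsq (add_nonneg hEα hEK)
  linarith

end Summit.RiemannHypothesis.RiemannHypothesis.Theorems.IntegerScrew

end
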